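import Summits.KontsevichZagierPeriods.KontsevichZagierPeriods.Theorems.HurwitzMicroSectorsNormalFormPrinciplePiBoxUnitBox
import Summits.KontsevichZagierPeriods.KontsevichZagierPeriods.Theorems.HurwitzMicroSectorsNormalFormPrincipleStubPiCalibration
import Summits.KontsevichZagierPeriods.KontsevichZagierPeriods.Theorems.HurwitzMicroSectorsNormalFormPrincipleStubSignKernelRep
import Summits.KontsevichZagierPeriods.KontsevichZagierPeriods.Theorems.HurwitzMicroSectorsNormalFormPrincipleStubSignKernelSplit

/-!
# `NormalFormPrinciple` (stmt-KontsevichZagierPeriods-3869), line `SketchIdeator1` ("π buys geometry") —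
# the sign-kernel step and the sign-kernel tower

Second support file of the lead's stub `stub_volumePiBox`, proving the registered sub-goal `tower`.
THE SIGN-KERNEL STEP (`signKernelStep`, from the landed stubs `stub_signKernelRep`,
`stub_signKernelSplit`, `stub_piCalibration`): for a representation `[D, g]` and a polynomial `Q`,
`[π]·[{x ∈ D, Q(x) > 0}, g] ≡ [{x ∈ D, Q ≠ 0} × [0,1], g(x)·(Q/(Q²(1−u)²+u²) + 1/((1−u)²+u²))]` —
one strict inequality of the domain is sold for one rational factor of the integrand at the price of
one `[π]` (`[π] ≡ 2•κ`, `κ = [[0,1], du/((1−u)²+u²)]`; `[π]·[D₊] ≡ [D₊]·[π]` by commutation of the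
Fubini product modulo relations; the split `[ρ] ≡ [D₊×κ] − [D₋×κ]` by the fibrewise substitutions
`w = u/(u+(1−u)(±Q))`, rule 2); `[D_{≠0}×κ] ≡ [D₊×κ] + [D₋×κ]`, rule 1a); one integrand addition,
rule 1b)). THE TOWER (`tower`): iterating over polynomials `P₀,…,P_{k−1}` appends `k` kernel
coordinates: `[π]^k·[{Pⱼ > 0 ∀ j}, g] ≡ [{Pⱼ ≠ 0 ∀ j} × [0,1]^k, g(x)·∏ⱼ K(Pⱼ(x), uⱼ)]`.
Pure proof file (theorems only). Source for the calculus: M. Kontsevich, D. Zagier, *Periods*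
(2001), §1.2; the device is this project's (card `pi-buys-geometry`).
-/

noncomputable section

open MeasureTheory Set
open Literature.NumberTheory.Transcendental Literature.NumberTheory.Transcendental.KZ
open Literature.ModelTheory.ExponentialFields (IsSemialgebraic)

namespace Summit.KontsevichZagierPeriods.HurwitzMicroSectors.NormalFormPrinciple.PiBox

variable {n m : ℕ}

/-! ## The calibration kernel and sign restrictions -/

/-- The calibration kernel `κ = [[0,1], du/((1−u)²+u²)]` exists as a representation. [folklore] -/
theorem exists_kappa :
    ∃ κ : IntegralRep 1, κ.domain = {x | x 0 ∈ Set.Icc (0:ℝ) 1} ∧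
      κ.integrand = (fun x => 1 / ((1 - x 0) ^ 2 + x 0 ^ 2)) := by
  have hσ : IsSemialgebraic ℚ {x : Fin 1 → ℝ | x 0 ∈ Set.Icc (0:ℝ) 1} := by
    have h1 := Literature.ModelTheory.ExponentialFields.isSemialgebraic_setOf_eval_nonneg
      (k := ℚ) (R := ℝ) (MvPolynomial.X (0 : Fin 1))
    have h2 := Literature.ModelTheory.ExponentialFields.isSemialgebraic_setOf_eval_nonneg
      (k := ℚ) (R := ℝ) (1 - MvPolynomial.X (0 : Fin 1))
    have : {x : Fin 1 → ℝ | x 0 ∈ Set.Icc (0:ℝ) 1} =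
        {x | 0 ≤ MvPolynomial.aeval x (MvPolynomial.X (R := ℚ) (0 : Fin 1))} ∩
          {x | 0 ≤ MvPolynomial.aeval x (1 - MvPolynomial.X (R := ℚ) (0 : Fin 1))} := by
      ext x
      simp only [mem_setOf_eq, mem_Icc, MvPolynomial.aeval_X, map_sub, map_one, sub_nonneg,
        mem_inter_iff]
    rw [this]
    exact h1.inter h2
  have hpos : ∀ x : Fin 1 → ℝ, 0 < (1 - x 0) ^ 2 + x 0 ^ 2 := fun x => by
    nlinarith [sq_nonneg (x 0 - 1 / 2)]
  have hsa : IsSemialgebraicFunOn ℚ {x : Fin 1 → ℝ | x 0 ∈ Set.Icc (0:ℝ) 1}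
      (fun x => 1 / ((1 - x 0) ^ 2 + x 0 ^ 2)) := by
    refine (isSemialgebraicFunOn_aeval_div_aeval hσ (1 : MvPolynomial (Fin 1) ℚ)
      ((1 - MvPolynomial.X 0) ^ 2 + MvPolynomial.X 0 ^ 2) fun x _ => ?_).congr fun x _ => ?_
    · simp only [map_add, map_pow, map_sub, map_one, MvPolynomial.aeval_X]
      exact (hpos x).ne'
    · simp only [map_add, map_pow, map_sub, map_one, MvPolynomial.aeval_X]
  have hc : Continuous fun x : Fin 1 → ℝ => 1 / ((1 - x 0) ^ 2 + x 0 ^ 2) :=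
    Continuous.div continuous_const (by fun_prop) fun x => (hpos x).ne'
  have hK : IsCompact {x : Fin 1 → ℝ | x 0 ∈ Set.Icc (0:ℝ) 1} := by
    convert isCompact_univ_pi (fun _ : Fin 1 => isCompact_Icc (a := (0:ℝ)) (b := 1)) using 1
    ext x
    simp only [mem_setOf_eq, mem_univ_pi, Fin.forall_fin_one]
  exact ⟨⟨{x | x 0 ∈ Set.Icc (0:ℝ) 1}, fun x => 1 / ((1 - x 0) ^ 2 + x 0 ^ 2), hσ, hsa,
    hc.continuousOn.integrableOn_compact hK⟩, rfl, rfl⟩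

/-- Restriction of a representation to the positivity / negativity / non-vanishing set of a
polynomial. [folklore] -/
theorem exists_restrict_sign (r : IntegralRep n) (Q : MvPolynomial (Fin n) ℚ) :
    (∃ rp : IntegralRep n, rp.domain = {x | x ∈ r.domain ∧ 0 < MvPolynomial.aeval x Q} ∧
      rp.integrand = r.integrand) ∧
    (∃ rm : IntegralRep n, rm.domain = {x | x ∈ r.domain ∧ MvPolynomial.aeval x Q < 0} ∧
      rm.integrand = r.integrand) ∧
    (∃ r₀ : IntegralRep n, r₀.domain = {x | x ∈ r.domain ∧ MvPolynomial.aeval x Q ≠ 0} ∧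
      r₀.integrand = r.integrand) := by
  have hp : IsSemialgebraic ℚ {x | x ∈ r.domain ∧ 0 < MvPolynomial.aeval x Q} :=
    r.isSemialgebraic_domain.inter
      (Literature.ModelTheory.ExponentialFields.isSemialgebraic_setOf_eval_pos Q)
  have hm : IsSemialgebraic ℚ {x | x ∈ r.domain ∧ MvPolynomial.aeval x Q < 0} := by
    have := Literature.ModelTheory.ExponentialFields.isSemialgebraic_setOf_eval_pos
      (k := ℚ) (R := ℝ) (-Q)
    simp only [map_neg, neg_pos] at this
    exact r.isSemialgebraic_domain.inter this
  have h0 : IsSemialgebraic ℚ {x | x ∈ r.domain ∧ MvPolynomial.aeval x Q ≠ 0} :=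
    r.isSemialgebraic_domain.inter
      (Literature.ModelTheory.ExponentialFields.isSemialgebraic_setOf_eval_ne_zero Q)
  exact ⟨⟨r.restrict _ hp (fun x hx => hx.1), rfl, rfl⟩, ⟨r.restrict _ hm (fun x hx => hx.1), rfl, rfl⟩,
    ⟨r.restrict _ h0 (fun x hx => hx.1), rfl, rfl⟩⟩

/-- The product of a representation `[D, g]` with the calibration kernel `κ` has domain the band
`D × [0,1]` and integrand `g(x)/((1−u)²+u²)`. [folklore] -/
theorem prod_kappa_eq (s : IntegralRep n) (κ : IntegralRep 1)
    (hκd : κ.domain = {x | x 0 ∈ Set.Icc (0:ℝ) 1})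
    (hκi : κ.integrand = (fun x => 1 / ((1 - x 0) ^ 2 + x 0 ^ 2))) :
    (s.prod κ).domain = KZlog.band s.domain (fun _ => 0) (fun _ => 1) ∧
    (s.prod κ).integrand = fun z => s.integrand (Fin.init z) *
      (1 / ((1 - z (Fin.last n)) ^ 2 + z (Fin.last n) ^ 2)) := by
  have hinit : ∀ z : Fin (n + 1) → ℝ, (fun i => z (Fin.castAdd 1 i)) = Fin.init z := fun z => rfl
  have hlast : ∀ z : Fin (n + 1) → ℝ, z (Fin.natAdd n (0 : Fin 1)) = z (Fin.last n) := fun z => by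
    congr 1
  constructor
  · ext z
    simp only [IntegralRep.prod_domain, IntegralRep.mem_prodDomain, hκd, mem_setOf_eq, hinit,
      hlast, KZlog.mem_band, mem_Icc]
  · rw [IntegralRep.prod_integrand_eq]
    funext z
    rw [IntegralRep.prodFun_apply, hκi, hinit]
    simp only [hlast]

/-! ## The sign-kernel step -/

/-- **The sign-kernel step** (from `stub_signKernelRep`, `stub_signKernelSplit`,
`stub_piCalibration`): for `r = [D, g]` and a polynomial `Q`,
`[π]·[{x ∈ D, Q > 0}, g] ≡ [{x ∈ D, Q ≠ 0} × [0,1], g(x)·(Q/(Q²(1−u)²+u²) + 1/((1−u)²+u²))]`: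
`[π]·[D₊] ≡ [D₊]·(2•κ) = 2•[D₊ × κ]` (commutation, calibration), `[ρ] ≡ [D₊×κ] − [D₋×κ]` (split),
`[D_{≠0}×κ] ≡ [D₊×κ] + [D₋×κ]` (rule 1a) times `κ`), and `[ρ] + [D_{≠0}×κ]` is one representation by
rule 1b). [cite: KontsevichZagier2001, §1.2] -/
theorem signKernelStep (r : IntegralRep n) (Q : MvPolynomial (Fin n) ℚ) (rp : IntegralRep n)
    (hrpd : rp.domain = {x | x ∈ r.domain ∧ 0 < MvPolynomial.aeval x Q})
    (hrpi : rp.integrand = r.integrand) :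
    ∃ N : IntegralRep (n + 1),
      N.domain = KZlog.band {x | x ∈ r.domain ∧ MvPolynomial.aeval x Q ≠ 0} (fun _ => 0) (fun _ => 1) ∧
      N.integrand = (fun z => r.integrand (Fin.init z) *
        (MvPolynomial.aeval (Fin.init z) Q /
          ((MvPolynomial.aeval (Fin.init z) Q) ^ 2 * (1 - z (Fin.last n)) ^ 2 + z (Fin.last n) ^ 2) +
         1 / ((1 - z (Fin.last n)) ^ 2 + z (Fin.last n) ^ 2))) ∧
      of piRep * of rp - of N ∈ relations := by
  obtain ⟨ρ, hρd, hρi⟩ := stub_signKernelRep n r Q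
  obtain ⟨κ, hκd, hκi⟩ := exists_kappa
  obtain ⟨-, ⟨rm, hrmd, hrmi⟩, ⟨r₀, hr₀d, hr₀i⟩⟩ := exists_restrict_sign r Q
  obtain ⟨hpd, hpi⟩ := prod_kappa_eq rp κ hκd hκi
  obtain ⟨hmd, hmi⟩ := prod_kappa_eq rm κ hκd hκi
  obtain ⟨h0d, h0i⟩ := prod_kappa_eq r₀ κ hκd hκi
  -- the split
  have hsplit : of ρ - of (rp.prod κ) + of (rm.prod κ) ∈ relations :=
    stub_signKernelSplit n r.domain r.integrand Q ρ (rp.prod κ) (rm.prod κ) hρd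
      (fun z _ => by rw [hρi]) (by rw [hpd, hrpd]) (fun z _ => by rw [hpi, hrpi])
      (by rw [hmd, hrmd]) (fun z _ => by rw [hmi, hrmi])
  -- calibration: `[π]·[rp] ≡ 2•[rp × κ]`
  have hcal : of piRep * of rp - 2 • of (rp.prod κ) ∈ relations := by
    have h1 : of piRep * of rp - of rp * of piRep ∈ relations := mul_sub_mul_comm_mem_relations _ _
    have h2 : of rp * of piRep - of rp * (2 • of κ) ∈ relations := by
      rw [← mul_sub]
      exact mul_mem_relations_left_holds _ _ (stub_piCalibration κ hκd hκi)
    have h3 : of rp * (2 • of κ) = 2 • of (rp.prod κ) := by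
      rw [two_nsmul, two_nsmul, mul_add, of_mul_of]
    have : of piRep * of rp - 2 • of (rp.prod κ) =
        (of piRep * of rp - of rp * of piRep) + (of rp * of piRep - of rp * (2 • of κ)) := by
      rw [← h3]; abel
    rw [this]
    exact relations.add_mem h1 h2
  -- rule 1a) on the base, times `κ`: `[r₀ × κ] ≡ [rp × κ] + [rm × κ]`
  have hadd : of (r₀.prod κ) - of (rp.prod κ) - of (rm.prod κ) ∈ relations := by
    have hdom : r₀.domain = rp.domain ∪ rm.domain := by
      rw [hr₀d, hrpd, hrmd]
      ext x
      simp only [mem_setOf_eq, mem_union]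
      constructor
      · rintro ⟨hx, hQ⟩
        rcases lt_or_gt_of_ne hQ with h | h
        · exact Or.inr ⟨hx, h⟩
        · exact Or.inl ⟨hx, h⟩
      · rintro (⟨hx, h⟩ | ⟨hx, h⟩)
        · exact ⟨hx, h.ne'⟩
        · exact ⟨hx, h.ne⟩
    have hnull : volume (rp.domain ∩ rm.domain) = 0 := by
      have : rp.domain ∩ rm.domain = ∅ := by
        rw [hrpd, hrmd]
        ext x
        simp only [mem_inter_iff, mem_setOf_eq, mem_empty_iff_false, iff_false, not_and, not_lt,
          and_imp]
        intro _ h _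
        exact h.le
      rw [this, measure_empty]
    have hbase : of r₀ - of rp - of rm ∈ relations :=
      domainAddRel_subset_relations ⟨n, r₀, rp, rm, hdom, hnull,
        fun x _ => by rw [hr₀i, hrpi], fun x _ => by rw [hr₀i, hrmi], rfl⟩
    have := mul_mem_relations_right_holds _ (of κ) hbase
    simpa only [sub_mul, of_mul_of] using this
  -- the sum `[ρ] + [r₀ × κ]` as one representation (rule 1b))
  have hNd' : ρ.domain = (r₀.prod κ).domain := by rw [hρd, h0d, hr₀d]
  let N : IntegralRep (n + 1) :=
    { domain := ρ.domain
      integrand := fun z => r.integrand (Fin.init z) *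
        (MvPolynomial.aeval (Fin.init z) Q /
          ((MvPolynomial.aeval (Fin.init z) Q) ^ 2 * (1 - z (Fin.last n)) ^ 2 + z (Fin.last n) ^ 2) +
         1 / ((1 - z (Fin.last n)) ^ 2 + z (Fin.last n) ^ 2))
      isSemialgebraic_domain := ρ.isSemialgebraic_domain
      isSemialgebraicFunOn_integrand := by
        refine (IsSemialgebraicFunOn.add_holds ρ.isSemialgebraicFunOn_integrand
          (hNd' ▸ (r₀.prod κ).isSemialgebraicFunOn_integrand)).congr fun z _ => ?_
        simp only [Pi.add_apply, hρi, h0i, hr₀i, mul_add]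
      integrableOn := by
        refine (ρ.integrableOn.add (hNd' ▸ (r₀.prod κ).integrableOn)).congr_fun (fun z _ => ?_)
          (IntegralRep.measurableSet_domain_holds ρ)
        simp only [Pi.add_apply, hρi, h0i, hr₀i, mul_add] }
  have hsum : of N - of ρ - of (r₀.prod κ) ∈ relations :=
    integrandAddRel_subset_relations ⟨n + 1, N, ρ, r₀.prod κ, rfl, hNd'.symm, fun z _ => by
      simp only [N, Pi.add_apply, hρi, h0i, hr₀i, mul_add], rfl⟩
  refine ⟨N, hρd, rfl, ?_⟩
  have : of piRep * of rp - of N = (of piRep * of rp - 2 • of (rp.prod κ)) -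
      (of ρ - of (rp.prod κ) + of (rm.prod κ)) - (of (r₀.prod κ) - of (rp.prod κ) - of (rm.prod κ))
      - (of N - of ρ - of (r₀.prod κ)) := by
    rw [two_nsmul]; abel
  rw [this]
  exact relations.sub_mem (relations.sub_mem (relations.sub_mem hcal hsplit) hadd) hsum

/-! ## The tower: `k` kernels appended as last coordinates -/

/-- `(init w) ∘ castAdd k = w ∘ castAdd (k+1)` on `Fin (n + k + 1)`. [folklore] -/
theorem init_castAdd_eq {k : ℕ} (w : Fin (n + k + 1) → ℝ) :
    (fun i => Fin.init w (Fin.castAdd k i)) = fun i => w (Fin.castAdd (k + 1) i) := by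
  funext i
  simp only [Fin.init]
  congr 1

/-- `(init w) (natAdd n j) = w (natAdd n (castSucc j))` on `Fin (n + k + 1)`. [folklore] -/
theorem init_natAdd_eq {k : ℕ} (w : Fin (n + k + 1) → ℝ) (j : Fin k) :
    Fin.init w (Fin.natAdd n j) = w (Fin.natAdd n (Fin.castSucc j)) := by
  simp only [Fin.init]
  congr 1

/-- `w (last (n + k)) = w (natAdd n (last k))`. [folklore] -/
theorem last_eq_natAdd_last {k : ℕ} (w : Fin (n + k + 1) → ℝ) :
    w (Fin.last (n + k)) = w (Fin.natAdd n (Fin.last k)) := by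
  have : Fin.last (n + k) = Fin.natAdd n (Fin.last k) := Fin.ext (by simp)
  rw [this]

/-- **The sign-kernel tower.** For `r = [D, g]` in dimension `n` and polynomials `P₀,…,P_{k−1}`,
with `rc = [{x ∈ D, Pⱼ(x) > 0 ∀ j}, g]` the restriction to the strict cell:
`[π]^k · [rc] ≡ [N]` where `N` lives in dimension `n + k`, on the domain
`{x ∈ D, Pⱼ(x) ≠ 0 ∀ j} × [0,1]^k` (kernel coordinates `u_j = z (natAdd n j)`), with integrand
`g(x) · ∏ⱼ K(Pⱼ(x), uⱼ)`: `k` applications of `signKernelStep`, the `j`-th kernel appended as the last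
coordinate. [cite: KontsevichZagier2001, §1.2] -/
theorem tower :
    ∀ (k n : ℕ) (r : IntegralRep n) (P : Fin k → MvPolynomial (Fin n) ℚ) (rc : IntegralRep n),
    rc.domain = {x | x ∈ r.domain ∧ ∀ j, 0 < MvPolynomial.aeval x (P j)} →
    rc.integrand = r.integrand →
    ∃ N : IntegralRep (n + k),
      N.domain = {z | (fun i => z (Fin.castAdd k i)) ∈ r.domain ∧
        (∀ j, MvPolynomial.aeval (fun i => z (Fin.castAdd k i)) (P j) ≠ 0) ∧
        ∀ j, z (Fin.natAdd n j) ∈ Set.Icc (0:ℝ) 1} ∧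
      N.integrand = (fun z => r.integrand (fun i => z (Fin.castAdd k i)) *
        ∏ j, ((MvPolynomial.aeval (fun i => z (Fin.castAdd k i)) (P j)) / ((MvPolynomial.aeval (fun i => z (Fin.castAdd k i)) (P j)) ^ 2 * (1 - (z (Fin.natAdd n j))) ^ 2 + (z (Fin.natAdd n j)) ^ 2) + 1 / ((1 - (z (Fin.natAdd n j))) ^ 2 + (z (Fin.natAdd n j)) ^ 2))) ∧
      (fun x => of piRep * x)^[k] (of rc) - of N ∈ relations := by
  intro k
  induction k with
  | zero =>
    intro n r P rc hcd hci
    refine ⟨rc, ?_, ?_, by simp [relations.zero_mem]⟩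
    · rw [hcd]
      ext z
      simp
    · rw [hci]
      funext z
      simp
  | succ k ih =>
    intro n r P rc hcd hci
    -- the last polynomial and the first `k`
    set Pl := P (Fin.last k) with hPl
    set P' : Fin k → MvPolynomial (Fin n) ℚ := fun j => P (Fin.castSucc j) with hP'
    obtain ⟨⟨rt, hrtd, hrti⟩, -, -⟩ := exists_restrict_sign r Pl
    obtain ⟨⟨rc₁, hrc₁d, hrc₁i⟩, -, -⟩ :
        (∃ rp : IntegralRep n, rp.domain = {x | x ∈ r.domain ∧ ∀ j, 0 < MvPolynomial.aeval x (P' j)} ∧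
          rp.integrand = r.integrand) ∧ True ∧ True := by
      refine ⟨?_, trivial, trivial⟩
      have hs : IsSemialgebraic ℚ {x | x ∈ r.domain ∧ ∀ j, 0 < MvPolynomial.aeval x (P' j)} := by
        have : {x | x ∈ r.domain ∧ ∀ j, 0 < MvPolynomial.aeval x (P' j)} =
            r.domain ∩ ⋂ j ∈ (Finset.univ : Finset (Fin k)),
              {x | 0 < MvPolynomial.aeval x (P' j)} := by
          ext x; simp
        rw [this]
        exact r.isSemialgebraic_domain.inter (IsSemialgebraic.biInter _ _ fun j _ =>
          Literature.ModelTheory.ExponentialFields.isSemialgebraic_setOf_eval_pos _)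
      exact ⟨r.restrict _ hs (fun x hx => hx.1), rfl, rfl⟩
    -- `rc` is the cell of `P'` over the base `rt = [{Pl > 0}, g]`
    have hcd' : rc.domain = {x | x ∈ rt.domain ∧ ∀ j, 0 < MvPolynomial.aeval x (P' j)} := by
      rw [hcd, hrtd]
      ext x
      simp only [mem_setOf_eq, Fin.forall_fin_succ', hP', hPl]
      tauto
    have hci' : rc.integrand = rt.integrand := by rw [hci, hrti]
    obtain ⟨Nt, hNtd, hNti, hNt⟩ := ih n rt P' rc hcd' hci'
    obtain ⟨Nk, hNkd, hNki, -⟩ := ih n r P' rc₁ hrc₁d hrc₁i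
    -- the step in dimension `n + k`, polynomial `Pl` read in the first `n` coordinates
    set Q : MvPolynomial (Fin (n + k)) ℚ := MvPolynomial.rename (Fin.castAdd k) Pl with hQ
    have haQ : ∀ z : Fin (n + k) → ℝ,
        MvPolynomial.aeval z Q = MvPolynomial.aeval (fun i => z (Fin.castAdd k i)) Pl := fun z => by
      rw [hQ, MvPolynomial.aeval_rename]; rfl
    have hNt_dom : Nt.domain = {z | z ∈ Nk.domain ∧ 0 < MvPolynomial.aeval z Q} := by
      rw [hNtd, hNkd, hrtd]
      ext z
      simp only [mem_setOf_eq, haQ]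
      tauto
    have hNt_int : Nt.integrand = Nk.integrand := by rw [hNti, hNki, hrti]
    obtain ⟨N, hNd, hNi, hN⟩ := signKernelStep Nk Q Nt hNt_dom hNt_int
    refine ⟨N, ?_, ?_, ?_⟩
    · show N.domain = {z : Fin (n + k + 1) → ℝ | (fun i => z (Fin.castAdd (k + 1) i)) ∈ r.domain ∧
          (∀ j : Fin (k + 1), MvPolynomial.aeval (fun i => z (Fin.castAdd (k + 1) i)) (P j) ≠ 0) ∧
          ∀ j : Fin (k + 1), z (Fin.natAdd n j) ∈ Set.Icc (0:ℝ) 1}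
      rw [hNd, hNkd]
      ext w
      simp only [KZlog.mem_band, mem_setOf_eq, haQ, init_castAdd_eq, Fin.forall_fin_succ', mem_Icc,
        init_natAdd_eq, last_eq_natAdd_last, hP', hPl]
      tauto
    · rw [hNi, hNki]
      funext w
      simp only [haQ, init_castAdd_eq, init_natAdd_eq, last_eq_natAdd_last, Fin.prod_univ_castSucc,
        hP', hPl, mul_assoc]
    · simp only [Function.iterate_succ_apply']
      have h1 : of piRep * (fun x => of piRep * x)^[k] (of rc) - of piRep * of Nt ∈ relations := by
        rw [← piMul_sub]
        exact mul_mem_relations_left_holds _ _ hNt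
      have : of piRep * (fun x => of piRep * x)^[k] (of rc) - of N =
          (of piRep * (fun x => of piRep * x)^[k] (of rc) - of piRep * of Nt) + (of piRep * of Nt - of N) := by abel
      rw [this]
      exact relations.add_mem h1 hN
end Summit.KontsevichZagierPeriods.HurwitzMicroSectors.NormalFormPrinciple.PiBox
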